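import Literature.RepresentationTheory.BorelWallach2000.SUn1CohomologicalModules
import Literature.RepresentationTheory.BorelWallach2000.TrivialModuleGKCohomologyKaehlerPowers
import HarnessLib

/-!
# The row `J_{0,0}` of Borel–Wallach's `SU(n,1)` table: dictionary level versus the computed complex of `U(n,1)`

Topic `RepresentationTheory/BorelWallach2000`; namespace `Literature.RepresentationTheory.BorelWallach2000`.
Theorems only (no definition, no named fact, no `sorry`).

`SUn1CohomologicalModules` transcribes [BorelWallach2000, VI 4.7–4.12] as the PREDICATE `SUn1Table.VI_4_11` on a
dictionary `SUn1Table n` (nothing asserted); `TrivialModuleGKCohomology{,Unitary,Top,Un1Bound,KaehlerPowers}` COMPUTE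
the row of the trivial representation from the `(𝔤, K)`-complex of the tree's carrier `U(n,1) = uFormGroup (Fin n) Unit`
(`un1_finrank_gkCohomology_triv_complex_row : dim_ℂ H^q(𝔲(n,1), K; ℂ) = [q even ∧ q ≤ 2n]`).  This file joins them:

* `SUn1Table.jDegree_zero_zero_iff` — the printed degree condition of VI Thm. 4.11 (3) at `(i, j) = (0, 0)`,
  "`q = i + j + 2l` (`0 ≤ l ≤ n − i − j`)", is `q` even and `q ≤ 2n`;
* `SUn1Table.hdim_J00` — under `VI_4_11`: `dim H^q(J_{0,0}) = [q even ∧ q ≤ 2n]` (every `n ≥ 1`, every `q`);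
* `SUn1Table.fmult_J00`, **`SUn1Table.homKdim_J00`** — under `VI_4_11`: `J_{0,0}` contains `F_{0,0}` once and no
  other `F_{p,q}` ((9)), hence by Lemma 4.9 (1) iterated (`Λ^{p,q} = LΛ^{p−1,q−1} ⊕ F_{p,q}`) and 4.8 (5):
  **`dim Hom_K(Λ^{p,q}, J_{0,0}) = [p = q]`** for `p + q ≤ n` — the classes of the trivial representation are of
  pure type `(p, p)` (the powers `L^p` of the Kähler class, VI 4.8 (4));
* **`SUn1Table.hdim_J00_eq_finrank_gkCohomology`** — for EVERY dictionary `T : SUn1Table n` (`n ≥ 1`) satisfying the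
  transcribed theorem `VI_4_11`, the entry `dim H^q(J_{0,0})` EQUALS the dimension `dim_ℂ H^q(𝔲(n,1), K; ℂ)` computed
  from the complex of the tree's `U(n,1)` (trivial `(𝔤, K)`-module; `U(n,1)` and `SU(n,1)` have the same `𝔭 = 𝔤/𝔨` and
  the centre acts trivially on `Λ^•𝔭`): the `J_{0,0}` clauses of the transcription are CONSISTENT with the kernel's
  computation.

## References

* A. Borel, N. Wallach, *Continuous cohomology, discrete subgroups, and representations of reductive groups*, 2nd ed.,
  AMS (2000): VI 4.8 (4)–(5), Lemma 4.9 (1), Thm. 4.11 (3) with its proof (9), (11) (held, chunks p0166–p0169);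
  I §1.6 (2) (`H^•(ℙⁿ(ℂ))`). [BorelWallach2000]
-/

noncomputable section

namespace Literature.RepresentationTheory.BorelWallach2000

open Literature.NumberTheory.Automorphic Literature.NumberTheory.Automorphic.GKTrivialTensor
open Literature.RepresentationTheory.KonnoKonno2007

namespace SUn1Table

universe u

variable {n : ℕ} (T : SUn1Table.{u} n)

/-- **The degrees of `J_{0,0}`**: "`q = i + j + 2l` (`0 ≤ l ≤ n − i − j`)" at `(i,j) = (0,0)` means `q` even and
`q ≤ 2n` (the degrees `0, 2, …, 2n` of `H^•(ℙⁿ(ℂ))`). [cite: BorelWallach2000, VI Thm. 4.11 (3)] -/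
theorem jDegree_zero_zero_iff (n q : ℕ) : JDegree n 0 0 q ↔ Even q ∧ q ≤ 2 * n := by
  constructor
  · rintro ⟨l, hl, hq⟩
    exact ⟨⟨l, by omega⟩, by omega⟩
  · rintro ⟨⟨l, hl⟩, hq⟩
    exact ⟨l, by omega, by omega⟩

/-- **`dim H^q(J_{0,0}) = [q even ∧ q ≤ 2n]`** under the transcribed Theorem 4.11 (the row of the trivial
representation, `n ≥ 1`). [cite: BorelWallach2000, VI Thm. 4.11 (3)] -/
theorem hdim_J00 (hT : T.VI_4_11) (h : 0 + 0 + 1 ≤ n) (q : ℕ) :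
    T.hdim (T.J 0 0 h) q = if Even q ∧ q ≤ 2 * n then 1 else 0 := by
  have h3 := hT.2.2.1 0 0 h q
  by_cases hq : Even q ∧ q ≤ 2 * n
  · rw [if_pos hq]
    exact h3.1 ((jDegree_zero_zero_iff n q).2 hq)
  · rw [if_neg hq]
    exact h3.2 (fun hd => hq ((jDegree_zero_zero_iff n q).1 hd))

/-- **`J_{0,0}` contains `F_{0,0}` once and no other `F_{p,q}`** (`p + q ≤ n`): `dim Hom_K(F_{p,q}, J_{0,0}) = [(p,q) = (0,0)]`.
[cite: BorelWallach2000, VI Thm. 4.11 (9)] -/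
theorem fmult_J00 (hT : T.VI_4_11) (h : 0 + 0 + 1 ≤ n) (p q : ℕ) (hpq : p + q ≤ n) :
    T.fmult (T.J 0 0 h) p q = if p = 0 ∧ q = 0 then 1 else 0 := by
  have h9 := hT.2.2.2.1 0 0 h p q hpq
  by_cases hp : p = 0 ∧ q = 0
  · rw [if_pos hp]; exact h9.1 hp
  · rw [if_neg hp]; exact h9.2 hp

/-- **`dim Hom_K(Λ^{p,q}, J_{0,0}) = [p = q]` for `p + q ≤ n`**: by Lemma 4.9 (1) iterated
(`Λ^{p,q} = LΛ^{p−1,q−1} ⊕ F_{p,q}`), 4.8 (5) (`Λ^{p,0} = F_{p,0}`, `Λ^{0,q} = F_{0,q}`) and (9), the trivial `K`-type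
`F_{0,0}` occurs in `Λ^{p,q}` exactly when `p = q` (as `L^p Λ^{0,0}`): the cochains of the trivial representation are of
pure type `(p,p)`, the powers of the Kähler class `L` of VI 4.8 (4). [cite: BorelWallach2000, VI Lemma 4.9 (1), Thm. 4.11 (9)] -/
theorem homKdim_J00 (hT : T.VI_4_11) (h : 0 + 0 + 1 ≤ n) :
    ∀ (p q : ℕ), p + q ≤ n → T.homKdim (T.J 0 0 h) p q = if p = q then 1 else 0 := by
  have h49 := hT.2.2.2.2.1
  have h48 := hT.2.2.2.2.2.1
  intro p
  induction p with
  | zero =>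
    intro q hq
    rw [(h48 (T.J 0 0 h) q (by omega)).2, T.fmult_J00 hT h 0 q (by omega)]
    by_cases hq0 : q = 0
    · subst hq0; simp
    · rw [if_neg (fun h' => hq0 h'.2), if_neg (fun h' => hq0 h'.symm)]
  | succ p ih =>
    intro q hq
    cases q with
    | zero =>
      rw [(h48 (T.J 0 0 h) (p + 1) (by omega)).1, T.fmult_J00 hT h (p + 1) 0 (by omega),
        if_neg (show ¬(p + 1 = 0 ∧ 0 = 0) from fun h' => Nat.succ_ne_zero p h'.1),
        if_neg (show ¬(p + 1 = 0) from fun h' => Nat.succ_ne_zero p h')]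
    | succ q =>
      rw [h49 (T.J 0 0 h) p q (by omega), ih q (by omega), T.fmult_J00 hT h (p + 1) (q + 1) (by omega),
        if_neg (show ¬(p + 1 = 0 ∧ q + 1 = 0) from fun h' => Nat.succ_ne_zero p h'.1), add_zero]
      by_cases hpq : p = q
      · subst hpq; simp
      · rw [if_neg hpq, if_neg (fun h' => hpq (Nat.succ_injective h'))]

/-- **The `J_{0,0}` row of the dictionary agrees with the row computed from the complex of `U(n,1)`**: for every
`T : SUn1Table n` (`n ≥ 1`) satisfying the transcribed Theorem 4.11, `dim H^q(J_{0,0})` equals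
`dim_ℂ H^q(𝔲(n,1), K; ℂ)` as computed from the `(𝔤, K)`-cochains of the tree's carrier `uFormGroup (Fin n) Unit` with
trivial coefficients (`un1_finrank_gkCohomology_triv_complex_row`) — both are `[q even ∧ q ≤ 2n]`, the Betti numbers of
`ℙⁿ(ℂ)` (I §1.6 (2)). [cite: BorelWallach2000, VI Thm. 4.11 (3), I §1.6 (2)] -/
theorem hdim_J00_eq_finrank_gkCohomology (hT : T.VI_4_11) (h : 0 + 0 + 1 ≤ n) (q : ℕ) :
    T.hdim (T.J 0 0 h) q =
      Module.finrank ℂ (gkCohomology (uFormGroup (Fin n) Unit) (trivK (uFormGroup (Fin n) Unit) (E := ℂ))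
        (trivLie (uFormGroup (Fin n) Unit)) (had_trivial (uFormGroup (Fin n) Unit)) q) := by
  rw [T.hdim_J00 hT h q, un1_finrank_gkCohomology_triv_complex_row]

/-- In particular, under `VI_4_11` (`n ≥ 1`): `H^q(J_{0,0}) ≠ 0` iff `H^q(𝔲(n,1), K; ℂ) ≠ 0` (computed), iff `q` is even and
`q ≤ 2n`. [cite: BorelWallach2000, VI Thm. 4.11 (3)] -/
theorem hdim_J00_ne_zero_iff (hT : T.VI_4_11) (h : 0 + 0 + 1 ≤ n) (q : ℕ) :
    T.hdim (T.J 0 0 h) q ≠ 0 ↔ Even q ∧ q ≤ 2 * n := by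
  rw [T.hdim_J00 hT h q]
  by_cases hq : Even q ∧ q ≤ 2 * n
  · rw [if_pos hq]; exact ⟨fun _ => hq, fun _ => one_ne_zero⟩
  · rw [if_neg hq]; exact ⟨fun h0 => absurd rfl h0, fun h' => absurd h' hq⟩

end SUn1Table

end Literature.RepresentationTheory.BorelWallach2000
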